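import Mathlib
import HarnessLib
import Summits.CriticalPhenomena.SAWScalingLimit.Theses.SAWDefectDecoherence
import Literature.Probability.RandomPlanarGeometry.HexParafermion
import Literature.Probability.RandomPlanarGeometry.HexSAW
import Literature.Probability.RandomPlanarGeometry.HexSAWStrip
import Literature.Probability.RandomPlanarGeometry.HexSAWLowerBound

/-!
# Sketch — crux MassRatio (stmt-CriticalPhenomena-8550), crux-ideate round 1, ideator 3

First lemmas of the idea cards `Ideas/punctured-sum-rule-occupation.md` and
`Ideas/pinched-double-bridge-gain.md`.  Statements only (`def … : Prop`); nothing is proved here.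
-/

namespace Summit.CriticalPhenomena.SAWScalingLimit.Cruxes.MassRatio.Sketch

open Literature.Probability.LatticeModels Literature.Probability.RandomPlanarGeometry.SAW

/-- Card `punctured-sum-rule-occupation`, first lemma (PuncturedVertexRelation): the
Duminil-Copin–Smirnov vertex relation survives ONE interior puncture when the root is on the OUTER
boundary.  `Λ` simply connected, root `a = {u,w}` (`u ∉ Λ ∋ w`), `v ∈ Λ` with its three neighbours
in `Λ`; then at every vertex `y` of the punctured vertex set `Λ.erase v` the relation (1) holds for
the observable OF THE PUNCTURED DOMAIN (`x = x_c`, `σ = 5/8`).  (The tree's Lemma 1 asks for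
`hexDomainSimplyConnected`, which `Λ.erase v` violates: `v` is an isolated point of the complement.) -/
def PuncturedVertexRelation : Prop :=
  ∀ (Λ : Finset HexVertex), hexDomainSimplyConnected Λ →
    ∀ (u w : HexVertex), hexGraph.Adj u w → u ∉ Λ → w ∈ Λ →
    ∀ v ∈ Λ, (∀ t : HexVertex, hexGraph.Adj v t → t ∈ Λ) →
    ∀ y ∈ Λ.erase v, ∀ p q r : HexVertex,
      hexGraph.Adj y p → hexGraph.Adj y q → hexGraph.Adj y r → p ≠ q → q ≠ r → p ≠ r →
        (hexMidpoint s(y, p) - hexCenter y) *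
            hexParafermionicObservable (Λ.erase v) s(u, w) hexCriticalFugacity (5 / 8) s(y, p) +
          (hexMidpoint s(y, q) - hexCenter y) *
            hexParafermionicObservable (Λ.erase v) s(u, w) hexCriticalFugacity (5 / 8) s(y, q) +
          (hexMidpoint s(y, r) - hexCenter y) *
            hexParafermionicObservable (Λ.erase v) s(u, w) hexCriticalFugacity (5 / 8) s(y, r) = 0

/-- Card `punctured-sum-rule-occupation`, corollary form (PuncturedSumRule = "visit sum rule"):
summing `PuncturedVertexRelation` over `Λ.erase v` and subtracting the unpunctured sum rule, the
outer-boundary sum of `(mid_z − c_{w_z})·(F_Λ − F_{Λ∖v})(z)` — whose walk-by-walk phases are RIGID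
(planar Umlaufsatz, holes irrelevant) and whose moduli are the NON-NEGATIVE visit masses
`G_Λ(a,z)·P_{a→z}(v ∈ γ)` — equals minus the flux of `F_{Λ∖v}` into the puncture. -/
def PuncturedSumRule : Prop :=
  ∀ (Λ : Finset HexVertex), hexDomainSimplyConnected Λ →
    ∀ (u w : HexVertex), hexGraph.Adj u w → u ∉ Λ → w ∈ Λ →
    ∀ v ∈ Λ, (∀ t : HexVertex, hexGraph.Adj v t → t ∈ Λ) →
      (∑ᶠ p ∈ {p : HexVertex × HexVertex | hexGraph.Adj p.1 p.2 ∧ p.1 ∉ Λ ∧ p.2 ∈ Λ},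
          (hexMidpoint s(p.1, p.2) - hexCenter p.2) *
            (hexParafermionicObservable Λ s(u, w) hexCriticalFugacity (5 / 8) s(p.1, p.2) -
              hexParafermionicObservable (Λ.erase v) s(u, w) hexCriticalFugacity (5 / 8)
                s(p.1, p.2))) +
        ∑ t ∈ Λ.filter (fun t => hexGraph.Adj v t),
          (hexMidpoint s(v, t) - hexCenter v) *
            hexParafermionicObservable (Λ.erase v) s(u, w) hexCriticalFugacity (5 / 8) s(v, t) = 0

/-- Card `punctured-sum-rule-occupation`, the positive consequence actually used downstream
(OccupationBound): in a domain whose boundary windings from the root stay in `(-4π/3, 4π/3)`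
("tame": all boundary cosines `≥ c₀ > 0`), the boundary-mass-weighted probability that the walk
VISITS the interior vertex `v` is at most `c₀⁻¹` times the `x_c`-mass arriving at the three
mid-edges of `v` from outside `v` (continuation from an occupied bulk vertex is `O(1)`).  Stated with
the tameness folded into an abstract constant, for the spin-0 masses `Z = F_{x_c,0}`. -/
def OccupationBound : Prop :=
  ∃ C : ℝ, ∀ (Λ : Finset HexVertex), hexDomainSimplyConnected Λ →
    ∀ (u w : HexVertex), hexGraph.Adj u w → u ∉ Λ → w ∈ Λ →
    (∀ (b o : HexVertex), hexGraph.Adj o b → o ∉ Λ → b ∈ Λ →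
        ∀ γ : HexMidEdgeSAW Λ s(u, w) s(o, b), |γ.winding| < 4 * Real.pi / 3 - 1 / 10) →
    ∀ v ∈ Λ, (∀ t : HexVertex, hexGraph.Adj v t → t ∈ Λ) →
      (∑ᶠ p ∈ {p : HexVertex × HexVertex | hexGraph.Adj p.1 p.2 ∧ p.1 ∉ Λ ∧ p.2 ∈ Λ},
          (‖hexParafermionicObservable Λ s(u, w) hexCriticalFugacity 0 s(p.1, p.2)‖ -
            ‖hexParafermionicObservable (Λ.erase v) s(u, w) hexCriticalFugacity 0 s(p.1, p.2)‖)) ≤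
        C * ∑ t ∈ Λ.filter (fun t => hexGraph.Adj v t),
          ‖hexParafermionicObservable (Λ.erase v) s(u, w) hexCriticalFugacity 0 s(v, t)‖

/-- Card `pinched-double-bridge-gain`, first lemma (GainRecursion): Duminil-Copin–Smirnov's
induction `B_T ≥ c/T` run with an INTERSECTION GAIN `ε_T` in the cutting inequality.  If
`1 = c_α A_T + B_T` (the strip identity with `E_T = 0`) and
`A_{T+1} − A_T ≤ ε_{T+1} x_c⁻¹ B_{T+1}²` (the cut pair of bridges is MUTUALLY AVOIDING, which costs
`ε`), then `1/B_T ≤ 1/B_1 + c_α x_c⁻¹ Σ_{t=2}^{T} ε_t`; so `ε_t ≤ C t^{-κ}` gives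
`B_T ≥ c T^{-(1-κ)}`, the first boundary tail below the random-walk value.  Over the tree's
`HV.stripAlim`, `HV.stripBlim` (HexSAWLowerBound.lean). -/
def GainRecursion : Prop :=
  ∀ ε : ℕ → ℝ, (∀ T, 0 ≤ ε T) →
    (∀ T : ℕ, 1 ≤ T → (1 : ℝ) = Real.cos (3 * Real.pi / 8) * HV.stripAlim T + HV.stripBlim T) →
    (∀ T : ℕ, 1 ≤ T → 0 < HV.stripBlim T) →
    (∀ T : ℕ, 1 ≤ T →
        HV.stripAlim (T + 1) ≤ HV.stripAlim T + ε (T + 1) * hexCriticalFugacity⁻¹ * HV.stripBlim (T + 1) ^ 2) →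
    ∀ T : ℕ, 1 ≤ T →
      (HV.stripBlim T)⁻¹ ≤ (HV.stripBlim 1)⁻¹ +
        Real.cos (3 * Real.pi / 8) * hexCriticalFugacity⁻¹ * ∑ t ∈ Finset.Icc 2 T, ε t

/-- Card `pinched-double-bridge-gain`, the load-bearing stub in the tree's finite-strip language
(IntersectionGain): the cutting inequality `stripA_succ_le` improved by a polynomial factor —
the two bridges produced by cutting a far-reaching returning walk at its first visit to the far
column are vertex-disjoint and pinched at adjacent far mid-edges, and such PINCHED DOUBLE BRIDGES
carry at most `C (T+1)^{-κ}` of the product mass.  `κ > 0` is the claim; the prediction is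
`κ = 3/4 = h^b_2 − 2h^b_1` (boundary two-leg weight 2, Lawler–Schramm–Werner `ξ̃(5/8,5/8) = 2`). -/
def IntersectionGain : Prop :=
  ∃ κ C : ℝ, 0 < κ ∧ ∀ T L : ℕ, 1 ≤ T →
    HV.stripA (T + 1) L hexCriticalFugacity ≤ HV.stripA T L hexCriticalFugacity +
      C * ((T : ℝ) + 1) ^ (-κ) * hexCriticalFugacity⁻¹ *
        (HV.stripB (T + 1) L hexCriticalFugacity * HV.stripB (T + 1) (2 * L) hexCriticalFugacity)

end Summit.CriticalPhenomena.SAWScalingLimit.Cruxes.MassRatio.Sketch
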